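import Summits.BirchSwinnertonDyer.BirchSwinnertonDyer.Theorems.ResidualThetaTransportAtTwoResidualSignedLambdaLowerCMAtTwoAtTwoCharacter
import Summits.BirchSwinnertonDyer.BirchSwinnertonDyer.Theorems.ResidualThetaTransportAtTwoResidualSignedLambdaLowerCMAtTwoRhoLayerPairingConjGlue
import Summits.BirchSwinnertonDyer.BirchSwinnertonDyer.Theorems.ResidualThetaTransportAtTwoResidualSignedLambdaLowerCMAtTwoRhoLayerPairingGlueAwayTwo
import Literature.NumberTheory.EllipticCurves.GreenbergSelmerDualDataExistsProofs
import Literature.NumberTheory.EllipticCurves.GreenbergSelmer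
import HarnessLib

/-!
# GLUE clause (5) AT THE PINS: the `ℤ₂`-compatibilities `hpair`, `hlocd` of the one-pair supply — naturality of `loc_w` in the scalars `𝒪`

Route `ResidualThetaTransportAtTwo` (RTT), crux RSL_g `ResidualSignedLambdaLowerCMAtTwo` (stmt-BirchSwinnertonDyer-22608), line «onepair» (v3d), ASSEMBLY-SPEC-g19
§1 row C5 `SupplyCompat` — everything that does not need the supply datum's names (`supplyPair = c̄₂ ⊕ pairAway`, `supplyLocd = (cvec, locdS)`).
Seat `prover-bsd-wall-tp2-p2x-w2` g20 (`--supports`, closes nothing). THEOREMS ONLY. BSD is not proved by any of this.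

* §1 naturality: `OnePair.locKer_scalarH1` — `loc_w (a · s) = a · loc_w s` (`scalarH1` on `H¹(Γ_∞, A_ρ)` versus `DlocSMul` on `D_w`; on cocycles both are
  `τ ↦ a • φ (res τ)`), `OnePair.locAway_scalarH1` (with `conjH1_comp_scalarH1`).
* §2 at the pins (binder structures `[Module 𝒪 ↥Sg]` pinned by `hSgO`, `[Module ℤ₂ (Dloc … w)]` pinned by `πₐ.hD` / `π₂.hD₂`):
  `OnePairPins.c₂_smul_locKer` (`c₂ (a • t) (loc₂ s) = c₂ t (loc₂ (ι a • s))`), `OnePairPins.sum_smul_locAway`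
  (`Σ (a • χ) w c (locAway s w c) = Σ χ w c (locAway (ι a • s) w c)`), **`OnePairPins.locd_coeff_smul`** — `hlocd`: for ANY additive `locd` with
  `locd x = (π.cvec x, πₐ.locdS x)` and the habitat's `𝒪`-structure on `𝐇¹` (`hOC : a • x = C a • x`), `locd (ι a • x) = a • locd x`
  (`cTuple_mapCoeff_C_smul` + `πₐ.hlocdS_smul`), and **`OnePairPins.c₂_add_sum_smul_eq`** (the `hpair` integrand:
  `c₂ (a • t) (loc₂ s) + Σ (a • χ)(locAway s) = c₂ t (loc₂ (ι a • s)) + Σ χ (locAway (ι a • s))`).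

References: [NeukirchSchmidtWingberg2008] I §5 (functoriality of `H¹` in compatible pairs); [Greenberg1989] §1 p. 98; [Kobayashi2003] Thm. 6.2, (8.23) (p. 18);
[Kato2004Asterisque] §12.2 (p. 220), §13.8 (p. 228); [EmertonPollackWeston2006] §3.1.
-/

set_option autoImplicit false
-- the Theorems namespace of this sub repeats the summit name by design (D-0017 nested layout)
set_option linter.dupNamespace false

noncomputable section

open scoped Classical

namespace Summit.BirchSwinnertonDyer.BirchSwinnertonDyer.Theorems.OnePair

open CategoryTheory Field NumberField IsDedekindDomain
  Literature.NumberTheory.EllipticCurves Literature.NumberTheory.GaloisRepresentations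
  Literature.NumberTheory.EllipticCurves.GreenbergSelmer Literature.NumberTheory.EllipticCurves.CyclotomicLayer
  Literature.NumberTheory.EllipticCurves.Kato2004 ZpExtension
  Summit.BirchSwinnertonDyer.BirchSwinnertonDyer.Theorems.ThetaTransport

variable {S : Set (PadicAlgCl 2)} {κ : ZpExtension ℚ 2} {ρ : FramedGaloisRep ℚ ↥(padicCoeffIntegers S) 2}

/-! ## §1 Naturality of `loc_w` in the scalars -/

/-- **`loc_w (a · s) = a · loc_w s`**: the frame's localisation `locKer S κ ρ w : H¹(Γ_∞, A_ρ) → D_w` intertwines the scalar `a ∈ 𝒪` acting as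
`scalarH1` upstairs and as `DlocSMul` downstairs (on cocycles both sides are `τ ↦ a • φ (res τ)`). [cite: NeukirchSchmidtWingberg2008, I §5]
[cite: Greenberg1989, §1 p. 98] -/
theorem locKer_scalarH1 (w : HeightOneSpectrum (𝓞 ℚ)) (a : ↥(padicCoeffIntegers S))
    (s : subgroupH1 κ.kerSubgroup (Cofree ρ ↥(padicCoeffField S))) :
    locKer S κ ρ w (scalarH1 κ.kerSubgroup (Cofree ρ ↥(padicCoeffField S)) a s) = DlocSMul S κ ρ w a (locKer S κ ρ w s) := by
  obtain ⟨φ, rfl⟩ := oneCocycleClass_surjective (X := discreteTopRep ↥κ.kerSubgroup (Cofree ρ ↥(padicCoeffField S))) s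
  rw [scalarH1_oneCocycleClass]
  refine (locKer_oneCocycleClass S κ ρ w _).trans ?_
  obtain ⟨ψ', hψ', hval⟩ := AtTwoPackage.exists_cocycle_DlocSMul S κ ρ w a
    (contOneCocycles.pullback (resGalSubgroupOfEmb κ.kerSubgroup (closureEmb (K := ℚ) (w.adicCompletion ℚ)))
      (X := subgroupRep (cofreeGaloisModule S ρ).toTopRep κ.kerSubgroup) (Y := subgroupRep (localRepOf (cofreeGaloisModule S ρ) w) (kerGroup κ w))
      (TopRep.ofHom ⟨ContinuousLinearMap.id ℤ (Cofree ρ ↥(padicCoeffField S)), fun _ ↦ rfl⟩) φ)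
  have hR : DlocSMul S κ ρ w a (locKer S κ ρ w (oneCocycleClass _ φ)) = oneCocycleClass _ ψ' := by
    rw [hψ']
    exact congrArg (DlocSMul S κ ρ w a) (locKer_oneCocycleClass S κ ρ w φ)
  refine Eq.trans ?_ hR.symm
  refine congrArg (oneCocycleClass _) (Subtype.ext (ContinuousMap.ext fun τ ↦ ?_))
  change a • φ.1 (resGalSubgroupOfEmb κ.kerSubgroup (closureEmb (K := ℚ) (w.adicCompletion ℚ)) τ) = (ψ'.1 τ : Cofree ρ ↥(padicCoeffField S))
  rw [hval]
  rfl

/-- **Conjugation commutes with scalars** (pointwise form of `conjH1_comp_scalarH1`). [cite: NeukirchSchmidtWingberg2008, I §5] -/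
theorem conjH1_scalarH1 (σ : absoluteGaloisGroup ℚ) (a : ↥(padicCoeffIntegers S)) (s : subgroupH1 κ.kerSubgroup (Cofree ρ ↥(padicCoeffField S))) :
    conjH1 κ.kerSubgroup (Cofree ρ ↥(padicCoeffField S)) σ (scalarH1 κ.kerSubgroup (Cofree ρ ↥(padicCoeffField S)) a s) =
      scalarH1 κ.kerSubgroup (Cofree ρ ↥(padicCoeffField S)) a (conjH1 κ.kerSubgroup (Cofree ρ ↥(padicCoeffField S)) σ s) := by
  rw [← AddMonoidHom.comp_apply, conjH1_comp_scalarH1, AddMonoidHom.comp_apply]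

/-- **`locAway (a · s) w c = a · locAway s w c`** (`locAway s w c = loc_w (conj_{σ_c} s)`). [cite: Greenberg1989, §1 p. 98 (3)] [cite: NeukirchSchmidtWingberg2008, I §5] -/
theorem locAway_scalarH1 {S₀ : Finset (HeightOneSpectrum (𝓞 ℚ))} (a : ↥(padicCoeffIntegers S))
    (s : subgroupH1 κ.kerSubgroup (Cofree ρ ↥(padicCoeffField S))) (w : ↥S₀) (c : Cosets κ (w : HeightOneSpectrum (𝓞 ℚ))) :
    locAway S κ ρ S₀ (scalarH1 κ.kerSubgroup (Cofree ρ ↥(padicCoeffField S)) a s) w c = DlocSMul S κ ρ w a (locAway S κ ρ S₀ s w c) := by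
  rw [locAway, locAway, conjH1_scalarH1, locKer_scalarH1]

/-! ## §2 At the pins: the `hpair` integrand -/

variable {S₀ : Finset (HeightOneSpectrum (𝓞 ℚ))} {W : WeierstrassCurve ℚ} [W.IsElliptic] {γ : absoluteGaloisGroup ℚ} {n : ℕ}
  {Θ : ∀ v : HeightOneSpectrum (𝓞 ℚ), ((2 : ℕ) : 𝓞 ℚ) ∈ v.asIdeal → (Cofree ρ ↥(padicCoeffField S) ≃+ (Fin n → ↥(W.geomPrimaryTorsion 2)))}
  {hΘ : ∀ v hv (δ : absoluteGaloisGroup (v.adicCompletion ℚ)) m i,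
    Θ v hv (resGalOfEmb (closureEmb (K := ℚ) (v.adicCompletion ℚ)) δ • m) i = resGalOfEmb (closureEmb (K := ℚ) (v.adicCompletion ℚ)) δ • Θ v hv m i}
  {I : Kato2004.IwasawaH1DataCoeff (FramedGaloisRep.toGaloisRep ρ) 2 κ γ}
  {Sg : AddSubgroup (subgroupH1 κ.kerSubgroup (Cofree ρ ↥(padicCoeffField S)))} [Module ↥(padicCoeffIntegers S) ↥Sg]
  (π : OnePairPins S W κ γ S₀ n ρ Θ hΘ I Sg)
  (hSgO : ∀ (a : ↥(padicCoeffIntegers S)) (s : ↥Sg),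
    ((a • s : ↥Sg) : subgroupH1 κ.kerSubgroup (Cofree ρ ↥(padicCoeffField S))) = scalarH1 κ.kerSubgroup (Cofree ρ ↥(padicCoeffField S)) a s)

section AtTwo

variable [Module ℤ_[2] (Dloc S κ ρ π.v)] (π₂ : AtTwoPins S κ ρ S₀ W γ n Θ hΘ I Sg π)

include hSgO in
/-- **`c₂ (a • t) (loc₂ s) = c₂ t (loc₂ (ι a • s))`** — the 2-adic half of `hpair` at the pins (`hc₂_smul`, `hD₂`, §1, `hSgO`).
[cite: Kobayashi2003, Thm. 6.2 (p. 18)] [cite: Greenberg1989, §1 p. 98] -/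
theorem OnePairPins.c₂_smul_locKer (a : ℤ_[2])
    (t : (Fin n → ↥(Sprung2012.localTowerPointsOfEmb κ (closureEmb (K := ℚ) (π.v.adicCompletion ℚ)) W)) →+ ℤ_[2]) (s : ↥Sg) :
    π₂.c₂ (a • t) (locKer S κ ρ π.v (s : subgroupH1 κ.kerSubgroup (Cofree ρ ↥(padicCoeffField S)))) =
      π₂.c₂ t (locKer S κ ρ π.v ((padicIntToCoeffIntegers S a • s : ↥Sg) : subgroupH1 κ.kerSubgroup (Cofree ρ ↥(padicCoeffField S)))) := by
  rw [π₂.hc₂_smul, π₂.hD₂, hSgO, locKer_scalarH1]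

end AtTwo

section Away

variable [∀ w : ↥S₀, Module ℤ_[2] (Dloc S κ ρ (w : HeightOneSpectrum (𝓞 ℚ)))] (πₐ : AwayPins S κ ρ S₀ W γ n Θ hΘ I Sg π)

include πₐ hSgO in
/-- **`Σ_{w,c} (a • χ) w c (locAway s w c) = Σ_{w,c} χ w c (locAway (ι a • s) w c)`** — the `S₀`-half of `hpair` at the pins (`CharacterModule.smul_apply`,
`πₐ.hD`, §1, `hSgO`). [cite: GreenbergVatsal2000, §2 Prop. 2.4] [cite: Greenberg1989, §1 p. 98] -/
theorem OnePairPins.sum_smul_locAway (a : ℤ_[2]) (χ : PAway S κ ρ S₀) (s : ↥Sg) :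
    ∑ w : ↥S₀, ∑ᶠ c : Cosets κ (w : HeightOneSpectrum (𝓞 ℚ)),
        (a • χ) w c (locAway S κ ρ S₀ (s : subgroupH1 κ.kerSubgroup (Cofree ρ ↥(padicCoeffField S))) w c) =
      ∑ w : ↥S₀, ∑ᶠ c : Cosets κ (w : HeightOneSpectrum (𝓞 ℚ)),
        χ w c (locAway S κ ρ S₀ ((padicIntToCoeffIntegers S a • s : ↥Sg) : subgroupH1 κ.kerSubgroup (Cofree ρ ↥(padicCoeffField S))) w c) := by
  refine Finset.sum_congr rfl fun w _ ↦ finsum_congr fun c ↦ ?_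
  rw [Pi.smul_apply, Pi.smul_apply, CharacterModule.smul_apply, πₐ.hD, hSgO, locAway_scalarH1]

/-! ### `hlocd` (clause (5), second half) -/

-- `cTuple_mapCoeff_C_smul` fed with the full pin bundle elaborates at the 200k edge (fails at 100k) — guard per ops habit note
set_option maxHeartbeats 400000 in
omit hSgO in
include πₐ in
/-- **GLUE clause (5) `hlocd` AT THE PINS.** For ANY additive `locd : 𝐇¹ →+ Λⁿ × P_{S₀}` with `locd x = (π.cvec x, πₐ.locdS x)` and the habitat's `𝒪`-module
structure on `𝐇¹` (`hOC : a • x = C a • x`): `locd (ι a • x) = a • locd x` for `a ∈ ℤ₂` (`π.cvec` is `C`-semilinear by `cTuple_mapCoeff_C_smul` fed with the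
pins, `πₐ.locdS` by `hlocdS_smul`). [cite: Kato2004Asterisque, §12.2 (p. 220), §13.8 (p. 228)] [cite: Kobayashi2003, Thm. 6.2 (p. 18)] -/
theorem OnePairPins.locd_coeff_smul [Module ↥(padicCoeffIntegers S) I.H]
    (hOC : ∀ (a : ↥(padicCoeffIntegers S)) (x : I.H), a • x = (PowerSeries.C a : IwasawaAlgebraO S) • x)
    (locd : I.H →+ (Fin n → PowerSeries ℤ_[2]) × PAway S κ ρ S₀) (hlocd : ∀ x, locd x = (π.cvec x, πₐ.locdS x))
    (a : ℤ_[2]) (x : I.H) :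
    locd (padicIntToCoeffIntegers S a • x) = a • locd x := by
  -- `π.cvec` as an additive map
  let 𝒸 : I.H →+ (Fin n → PowerSeries ℤ_[2]) :=
    { toFun := π.cvec
      map_zero' := by
        funext i
        rw [OnePairPins.cvec_apply, map_zero, AddMonoidHom.zero_comp, map_zero, Pi.zero_apply]
      map_add' := fun x y ↦ by
        funext i
        rw [Pi.add_apply, OnePairPins.cvec_apply, OnePairPins.cvec_apply, OnePairPins.cvec_apply, map_add, AddMonoidHom.add_comp, map_add] }
  have hC : π.cvec (PowerSeries.map (padicIntToCoeffIntegers S) (PowerSeries.C a) • x) = (PowerSeries.C a : PowerSeries ℤ_[2]) • π.cvec x :=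
    cTuple_mapCoeff_C_smul S ρ W π.ePk π.hμPk π.hadd₁Pk π.hadd₂Pk π.hgalPk (Θ π.v π.hv) π.v (hΘ π.v π.hv) I π.pair π.hpair π.hlocd₂ π.col 𝒸
      (fun y i ↦ by rfl) a x
  rw [hOC, hlocd, hlocd, Prod.smul_mk, πₐ.hlocdS_smul, ← PowerSeries.map_C (padicIntToCoeffIntegers S) a, hC,
    PowerSeries.C_eq_algebraMap, algebraMap_smul]

/-! ### `hpair` (clause (5), first half): both halves together -/

variable [Module ℤ_[2] (Dloc S κ ρ π.v)] (π₂ : AtTwoPins S κ ρ S₀ W γ n Θ hΘ I Sg π)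

include πₐ hSgO in
/-- **GLUE clause (5) `hpair` AT THE PINS (integrand form).** For `a ∈ ℤ₂`, a functional `t`, `χ ∈ P_{S₀}` and `s ∈ Sg`:
`c₂ (a • t) (loc₂ s) + Σ_{w,c} (a • χ) w c (locAway s w c) = c₂ t (loc₂ (ι a • s)) + Σ_{w,c} χ w c (locAway (ι a • s) w c)` — so the supply pairing
`supplyPair (F, χ) s = c̄₂ F s + Σ…` satisfies `pair (a • p) s = pair p (ι a • s)` once `F = colN t` (`colN` linear and onto, LEAD's `…OnePairSupplyDefs`).
[cite: Kobayashi2003, Thm. 6.2, (8.23) (p. 18)] [cite: GreenbergVatsal2000, §2 Prop. 2.4] -/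
theorem OnePairPins.c₂_add_sum_smul_eq (a : ℤ_[2])
    (t : (Fin n → ↥(Sprung2012.localTowerPointsOfEmb κ (closureEmb (K := ℚ) (π.v.adicCompletion ℚ)) W)) →+ ℤ_[2]) (χ : PAway S κ ρ S₀) (s : ↥Sg) :
    π₂.c₂ (a • t) (locKer S κ ρ π.v (s : subgroupH1 κ.kerSubgroup (Cofree ρ ↥(padicCoeffField S)))) +
        ∑ w : ↥S₀, ∑ᶠ c : Cosets κ (w : HeightOneSpectrum (𝓞 ℚ)),
          (a • χ) w c (locAway S κ ρ S₀ (s : subgroupH1 κ.kerSubgroup (Cofree ρ ↥(padicCoeffField S))) w c) =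
      π₂.c₂ t (locKer S κ ρ π.v ((padicIntToCoeffIntegers S a • s : ↥Sg) : subgroupH1 κ.kerSubgroup (Cofree ρ ↥(padicCoeffField S)))) +
        ∑ w : ↥S₀, ∑ᶠ c : Cosets κ (w : HeightOneSpectrum (𝓞 ℚ)),
          χ w c (locAway S κ ρ S₀ ((padicIntToCoeffIntegers S a • s : ↥Sg) : subgroupH1 κ.kerSubgroup (Cofree ρ ↥(padicCoeffField S))) w c) := by
  rw [π.c₂_smul_locKer hSgO π₂, π.sum_smul_locAway hSgO πₐ]

end Away

end Summit.BirchSwinnertonDyer.BirchSwinnertonDyer.Theorems.OnePair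

end
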